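import Literature.MathematicalPhysics.QuantumFieldTheory.Balaban1983to89.B3Op116ScaleChains

/-!
# `Balaban1983to89.B3Op116MajorantConvolution` — T. Bałaban, *(Higgs)₂,₃ quantum fields in a finite volume. III. Renormalization*,
# Commun. Math. Phys. **88** (1983) 411–445 [Balaban1983Higgs3], (1.16) p. 414 / (2.6), (2.10) pp. 424–426:
# **THE (2.6)/(2.10) MULTI-SCALE MAJORANT CURRENCY IS CLOSED UNDER LATTICE CONVOLUTION — hence chains of EVERY length**
# (the engine behind *«for n, n′ sufficiently large, a kernel of the operator (1.16) is a sufficiently regular function of both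
# variables»*): two majorants convolved give a majorant of the same shape with the exponents ADDED and the rate HALVED, with no
# condition on the total exponent; the condition `Σa > d` enters only once, at the end, where the top scale dominates; the
# FOUR- and FIVE-KERNEL CHAINS `bond_chain4_le` / `bond_chain5_le` of the (1.16) kernel at `n + n′ = 3, 4` in the exact hypothesis
# shape of `bond_chain3_le`

statement-level skeleton of published theorems with citation tags; proofs where landed; nothing here is a claim about the Yang–Mills mass gap

PDF held: `paper:balaban1983-higgs-2-3-quantum-fields-finite-volume` p. 414 [PDF 4] ((1.16) and the two sentences quoted below), pp. 424, 426
[PDF 14, 16] ((2.5), (2.6), (2.10)); [Balaban1983RegularityDecay] = `paper:balaban1983-cmp89-regularity-decay` Sect. 5 p. 594 (lattice sums).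

CITATION HEADER (lean-in-tree rule).  T. Bałaban, CMP **88** (1983) 411–445 [Balaban1983Higgs3]: (1.16) p. 414, (2.5) p. 424, (2.6) p. 424,
(2.10) p. 426; T. Bałaban, *Regularity and decay of lattice Green's functions*, CMP **89** (1983) 571–597 [Balaban1983RegularityDecay], Sect. 5
Theorem p. 594 (uniform lattice sums).  Cell `lit-balaban` (HOME `run/shared/lean/pub/lit-balaban/`), Phase-2 proof seat **p33** gen 63 (unit
`lit-balaban-p33`, literature-prover-lit-balaban-p33-g63-0; free-target protocol G.5-34(d), TAKING HOME/STATUS.md 2026-08-23T04:41:03Z, cc r14 (owner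
of the (1.16) analytic programme, `DESIGN-B3-116-analytic.md`), p35 (FILE 4), p40 (FILE 5), r15 (fold owner)); SKELETON rows **B3.Eq1.16** /
**B3.Eq2.5** (owner r15) — LOCATED ENGINE FILE (no head claim), sibling of r14's `B3Op116ScaleChains` (FILE E), which it imports and never restates:
`conv2_le_max` (two exponential kernels on two scales), `profile_half_scale_le` (the uniform torus sum of [Balaban1983RegularityDecay] Sect. 5 at the
rate of a scale), `sum_site_le_sum_idx`, `rate_eq`, `sum_mesh_rpow_le` (top-dominated geometric scale sums), `bond_chain3_le` (the three-kernel chain),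
`HiggsCovariancePos.sum_site_dir` (bonds = sites × directions).  This file SERVES the request of the FILE-4 seat p35 gen 21 to r14 (HOME
`lit-balaban-r14/INBOX.md` 2026-08-23T03:43:47Z: *«`chain4_le`/`bond_chain4_le` in FILE E»*, named again as FILE 4's trigger in p35's closing line
HOME/STATUS.md 04:38:01Z) without touching FILE E.

WHAT IS PRINTED (verbatim, p. 414 [PDF 4]): *"Perhaps the simplest way is to treat it as an external field, because for n, n′ sufficiently large,
a kernel of the operator (1.16) is a sufficiently regular function of both variables. More exactly the Hölder norms of the covariant derivatives
of this kernel, the norms defined for example in the inequalities (I.2.24) and (I.2.25) of Proposition I.2.1, are exponentially decaying with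
the distance of the arguments and are uniformly bounded by O(1)(e(L^kε)^{1−α})^{n+n′}, where α > 0 but can be arbitrarily small. This estimate
follows easily from the properties of the propagators G_k(Ω, A) proved in the next paper."*  (2.6) p. 424: *"G_k(Ω,B̃) = Σ_{j=0}^{k−1} G^η_{(j)}(Ω,B̃)"*;
(2.10) p. 426: *"|G^η_{(j)}(Ω,B̃;x,x′)| ≤ O(1)(L^jη)^{−d+2}e^{−δ₁(L^jη)^{−1}|x−x′|}, and if the propagator is differentiated, then for each
differentiation, there is an additional factor (L^jη)^{−1} on the right side."*

THE CURRENCY (r14, FILE E / `B3Op116KernelRegularTorus` §1–§2, used verbatim here — no new definition).  A kernel factor of a chain of (1.16) is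
majorized, after (2.6) and (2.10), by a MULTI-SCALE MAJORANT
  `𝔪(c, a; δ)(x, y) := Σ_{j<k} c · (L^jε)^{a−d} · exp(−δ (L^jε)^{−1} · ε|x − y|)`        (`(L^jε) = P.mesh j`, `ε|x−y| = P.mesh 0 · tdist x y`),
exponent `a = 2` for an undifferentiated propagator, `a = 1` with one covariant derivative, `a = 0` with two (r14's table, `DESIGN-B3-116-analytic.md` §4.1);
in the statements below the majorants are written out as these sums (the letters `c`, `a − d`, `δ` in the displayed positions), exactly as in
`B3Op116ScaleChains.bond_chain3_le` and `B3Op116KernelRegularTorus.col_le`/`dcol_le`/`majorant_shift_le`.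

WHAT THIS FILE PROVES (all on the model's tori `HiggsLattice.Site P 0`, every `HiggsLattice.Params` with `L > 1`, uniform in the volume and in `k`).
* §1 `bump_mono_scale` / `bump_mono_rate` / `majorant_rate_mono`: the bump `exp(−δ(L^jε)^{−1}ε|x−y|)` increases with the scale `j` and decreases with
  the rate; a majorant at rate `δ` is below the same majorant at any rate `δ′ ≤ δ`.
* §2 **`majorant_le_top`** — THE PLACE WHERE «n, n′ SUFFICIENTLY LARGE» ENTERS: for a POSITIVE net exponent `s = a − d > 0` the scale sum is dominated by
  the top scale, `𝔪(c, a; δ)(x,y) ≤ c·(L^s − 1)^{−1}·(L^kε)^{s}·exp(−δ(L^kε)^{−1}ε|x−y|)` (`sum_mesh_rpow_le` + §1).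
* §3 `conv2_scales_le` (two (2.10)-bumps at scales `j₁`, `j₂` convolved over the SITES of `T_ε` cost the volume of the finer scale and keep half the
  decay of the coarser: `Σ_u e_{j₁}(x,u)e_{j₂}(u,y) ≤ N(8d/δ)^d·(L^{min(j₁,j₂)})^d·exp(−(δ/2)(L^{max(j₁,j₂)}ε)^{−1}ε|x−y|)`, from FILE E `conv2_le_max` +
  `profile_half_scale_le`) and `pair_scale_algebra` (`(L^{j₁}ε)^{a₁−d}(L^{j₂}ε)^{a₂−d}(L^{min})^d = (L^{j₁}ε)^{a₁}(L^{j₂}ε)^{a₂}((L^{max}ε)^d)^{−1}(ε^d)^{−1}`).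
* §4 `sum_sq_le_lower_add_upper` (a double scale sum regrouped by its larger index) and the two inner geometric sums.
* §5 **`conv_majorant_le` — CLOSURE UNDER CONVOLUTION**: for `a₁, a₂ > 0`, `0 < δ ≤ 1`,
  `Σ_u 𝔪(c₁, a₁; δ)(x,u)·𝔪(c₂, a₂; δ)(u,y) ≤ 𝔪(c₁c₂·K·(ε^d)^{−1}, a₁ + a₂; δ/2)(x,y)`,
  `K = N(8d/δ)^d·(L^{a₁}(L^{a₁} − 1)^{−1} + L^{a₂}(L^{a₂} − 1)^{−1})` — NO condition on `a₁ + a₂` versus `d`, so the lemma ITERATES along a chain of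
  any length (each contraction adds the exponents, halves the rate and costs one `(ε^d)^{−1}` = the `ε^{−d}` of a kernel read as a matrix entry).
* §6 kernel forms: `sum_kernel_mul_le` (nonnegative kernels `F(u) ≤ 𝔪₁(x,u)`, `G(u) ≤ 𝔪₂(u,y)` ⇒ `Σ_u F·G ≤ 𝔪₁₂(x,y)`), and the BOND form
  `sum_bond_kernel_mul_le` (majorants read at `b₋ = b.src`, the `d` directions cost a factor `d`).
* §7 `chain2_le` / `bond_chain2_le`: two kernels with `a₁ + a₂ > d` (the value clause at `n + n′ = 0` has `a = 2 > d` only for `d = 1`; recorded for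
  completeness and as the pattern of use of §2 after §5).
* §8 **`bond_chain4_le`** — THE FOUR-KERNEL CHAIN of the (1.16) kernel at `n + n′ = 3` ((n,n′) ∈ {(2,1),(1,2)}: four propagator factors, three
  `V_k`-insertions summed over the bonds `b₁, b₂, b₃` of `T_ε`), in the EXACT hypothesis shape of FILE E's `bond_chain3_le` (nonnegative `F₁ b₁`,
  `F₂ b₁ b₂`, `F₃ b₂ b₃`, `F₄ b₃` majorized at rate `δ` with exponents `a_i − d`, anchors `x / b.src / x′`, `a_i > 0`, `a₁ + a₂ + a₃ + a₄ > d`):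
  `Σ_{b₁,b₂,b₃} F₁F₂F₃F₄ ≤ C(N,d,L,δ,a)·c₁c₂c₃c₄·(ε^d)^{−3}·(L^kε)^{a₁+a₂+a₃+a₄−d}·exp(−(δ/8)(L^kε)^{−1}ε|x−x′|)` UNIFORMLY IN `k` — contract `(F₃,F₄)` by §6,
  weaken `F₁, F₂` to the rate `δ/2` (§1), apply `bond_chain3_le` at the rate `δ/2` with exponents `(a₁, a₂, a₃ + a₄)`.
* §9 `bond_chain5_le` — the five-kernel chain at `n + n′ = 4` ((n,n′) = (2,2)) by one more contraction in front of §8 (rate `δ/16`,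
  `(ε^d)^{−4}`); the pattern continues to any length.
* §10 (v1.1) **`sum_sq_majorant_le`** / `sum_sq_kernel_le` — the `ℓ²`-COLUMN of a majorant of ANY exponent `a` with `2a > d`:
  `Σ_u ε^d 𝔪(c,a;δ)(x,u)² ≤ C·c²·(L^kε)^{2a−d}` (the self-convolution of §5 at `y = x`, then §2) — the interface between an outer sup-segment of
  a long chain (contracted by §5 to one exponent `A = Σa_i ≥ 2`) and an `L²`-bounded middle (FILE E `sq_col_le` is the case `a = 2`).
HONEST SCOPE.  Pure lattice-sum lemmas on the model's tori (no propagator, no field, no region); nothing of (1.16) itself is asserted here — which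
chains occur, with which exponents, and the `L²` route for the chains with a twice-differentiated middle factor are r14's FILE 3(b)
(`B3Op116KernelRegularTorus`) and p35's FILE 4; the rate loss `δ ↦ δ/2` per contraction and the constants are not optimized (print: *"exponentially
decaying"*, no rate specified).  Theorems only: no `def`, no `def … : Prop`, no `sorry`; axioms standard.
-/

noncomputable section

open scoped BigOperators

namespace Literature.MathematicalPhysics.QuantumFieldTheory.Balaban1983to89.B3Op116MajorantConvolution

open B1Eq230FluctCov (Ix)
open B1Ineq234Concrete (nCol profile profile_nonneg')
open B1Ineq234LevelZero (tdist_comm)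
open B3Op116ScaleChains (conv2_le_max profile_half_scale_le profile_antitone sum_site_le_sum_idx rate_eq sum_mesh_rpow_le
  mesh_succ mesh_rpow_add mesh_rpow_natCast bond_chain3_le)
open HiggsCovariancePos (sum_site_dir)

variable {P : HiggsLattice.Params} {N : ℕ}

/-! ## §1 Monotonicity of the (2.10) bump in the scale and in the rate -/

section Bumps

/-- **The (2.10) bump grows with the scale**: `j ≤ j′ ⇒ exp(−δ(L^jε)^{−1}ε|x−y|) ≤ exp(−δ(L^{j′}ε)^{−1}ε|x−y|)` (`δ ≥ 0`): a coarser
piece decays more slowly. [cite: Balaban1983Higgs3, (2.10) p.426] -/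
theorem bump_mono_scale {δ : ℝ} (hδ : 0 ≤ δ) {j j' : ℕ} (hjj : j ≤ j') (x y : HiggsLattice.Site P 0) :
    Real.exp (-(δ * (P.mesh j)⁻¹ * (P.mesh 0 * (HiggsLattice.Site.tdist x y : ℝ))))
      ≤ Real.exp (-(δ * (P.mesh j')⁻¹ * (P.mesh 0 * (HiggsLattice.Site.tdist x y : ℝ)))) := by
  rw [rate_eq, rate_eq]
  apply Real.exp_le_exp.mpr
  have hL1 : (1 : ℝ) ≤ (P.L : ℝ) := by exact_mod_cast P.hL
  have ht : (0 : ℝ) ≤ (HiggsLattice.Site.tdist x y : ℝ) := Nat.cast_nonneg _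
  have hpow : (P.L : ℝ) ^ j ≤ (P.L : ℝ) ^ j' := pow_le_pow_right₀ hL1 hjj
  have hpos : (0 : ℝ) < (P.L : ℝ) ^ j := by positivity
  have hrate : δ / (P.L : ℝ) ^ j' ≤ δ / (P.L : ℝ) ^ j := div_le_div_of_nonneg_left hδ hpos hpow
  nlinarith

/-- **The (2.10) bump shrinks with the rate**: `δ′ ≤ δ ⇒ exp(−δ(L^jε)^{−1}ε|x−y|) ≤ exp(−δ′(L^jε)^{−1}ε|x−y|)`.
[cite: Balaban1983Higgs3, (2.10) p.426] -/
theorem bump_mono_rate {δ δ' : ℝ} (hδ : δ' ≤ δ) (j : ℕ) (x y : HiggsLattice.Site P 0) :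
    Real.exp (-(δ * (P.mesh j)⁻¹ * (P.mesh 0 * (HiggsLattice.Site.tdist x y : ℝ))))
      ≤ Real.exp (-(δ' * (P.mesh j)⁻¹ * (P.mesh 0 * (HiggsLattice.Site.tdist x y : ℝ)))) := by
  apply Real.exp_le_exp.mpr
  have ht : (0 : ℝ) ≤ (P.mesh j)⁻¹ * (P.mesh 0 * (HiggsLattice.Site.tdist x y : ℝ)) :=
    mul_nonneg (inv_nonneg.mpr (P.mesh_pos j).le) (mul_nonneg (P.mesh_pos 0).le (Nat.cast_nonneg _))
  have h : δ' * ((P.mesh j)⁻¹ * (P.mesh 0 * (HiggsLattice.Site.tdist x y : ℝ)))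
      ≤ δ * ((P.mesh j)⁻¹ * (P.mesh 0 * (HiggsLattice.Site.tdist x y : ℝ))) := mul_le_mul_of_nonneg_right hδ ht
  rw [mul_assoc, mul_assoc]
  linarith

/-- **A majorant at rate `δ` is below the same majorant at any smaller rate `δ′ ≤ δ`** (`c ≥ 0`). [cite: Balaban1983Higgs3, (2.6) p.424, (2.10) p.426] -/
theorem majorant_rate_mono {k : ℕ} {c e δ δ' : ℝ} (hc : 0 ≤ c) (hδ : δ' ≤ δ) (x y : HiggsLattice.Site P 0) :
    ∑ j ∈ Finset.range k, c * P.mesh j ^ e * Real.exp (-(δ * (P.mesh j)⁻¹ * (P.mesh 0 * (HiggsLattice.Site.tdist x y : ℝ))))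
      ≤ ∑ j ∈ Finset.range k, c * P.mesh j ^ e *
          Real.exp (-(δ' * (P.mesh j)⁻¹ * (P.mesh 0 * (HiggsLattice.Site.tdist x y : ℝ)))) :=
  Finset.sum_le_sum fun j _ =>
    mul_le_mul_of_nonneg_left (bump_mono_rate hδ j x y) (mul_nonneg hc (Real.rpow_nonneg (P.mesh_pos j).le e))

/-- A majorant is nonnegative (`c ≥ 0`). [cite: Balaban1983Higgs3, (2.6) p.424, (2.10) p.426] -/
theorem majorant_nonneg {k : ℕ} {c e δ : ℝ} (hc : 0 ≤ c) (x y : HiggsLattice.Site P 0) :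
    0 ≤ ∑ j ∈ Finset.range k, c * P.mesh j ^ e * Real.exp (-(δ * (P.mesh j)⁻¹ * (P.mesh 0 * (HiggsLattice.Site.tdist x y : ℝ)))) :=
  Finset.sum_nonneg fun j _ => mul_nonneg (mul_nonneg hc (Real.rpow_nonneg (P.mesh_pos j).le e)) (Real.exp_nonneg _)

end Bumps

/-! ## §2 The top scale dominates once the net exponent is positive («for n, n′ sufficiently large») -/

section Top

/-- **Top-scale domination of a majorant with POSITIVE net exponent** `s > 0` (`s = a − d` for a chain of total order `a > d`):
`Σ_{j<k} c(L^jε)^s exp(−δ(L^jε)^{−1}ε|x−y|) ≤ c(L^s − 1)^{−1}·(L^kε)^s·exp(−δ(L^kε)^{−1}ε|x−y|)` — the geometric sum of FILE E `sum_mesh_rpow_le`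
and the slowest bump (§1). This is the only place where the order count *«n, n′ sufficiently large»* of p. 414 is used.
[cite: Balaban1983Higgs3, (1.16) p.414, (2.6) p.424, (2.10) p.426] -/
theorem majorant_le_top (hL : 1 < P.L) {k : ℕ} {c s δ : ℝ} (hc : 0 ≤ c) (hs : 0 < s) (hδ : 0 ≤ δ) (x y : HiggsLattice.Site P 0) :
    ∑ j ∈ Finset.range k, c * P.mesh j ^ s * Real.exp (-(δ * (P.mesh j)⁻¹ * (P.mesh 0 * (HiggsLattice.Site.tdist x y : ℝ))))
      ≤ c / ((P.L : ℝ) ^ s - 1) * P.mesh k ^ s *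
          Real.exp (-(δ * (P.mesh k)⁻¹ * (P.mesh 0 * (HiggsLattice.Site.tdist x y : ℝ)))) := by
  set Ek : ℝ := Real.exp (-(δ * (P.mesh k)⁻¹ * (P.mesh 0 * (HiggsLattice.Site.tdist x y : ℝ)))) with hEk
  have hEk0 : 0 ≤ Ek := Real.exp_nonneg _
  calc ∑ j ∈ Finset.range k, c * P.mesh j ^ s * Real.exp (-(δ * (P.mesh j)⁻¹ * (P.mesh 0 * (HiggsLattice.Site.tdist x y : ℝ))))
      ≤ ∑ j ∈ Finset.range k, c * P.mesh j ^ s * Ek :=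
        Finset.sum_le_sum fun j hj =>
          mul_le_mul_of_nonneg_left (bump_mono_scale hδ (Finset.mem_range.1 hj).le x y)
            (mul_nonneg hc (Real.rpow_nonneg (P.mesh_pos j).le s))
    _ = c * Ek * ∑ j ∈ Finset.range k, P.mesh j ^ s := by
        rw [Finset.mul_sum]; exact Finset.sum_congr rfl fun j _ => by ring
    _ ≤ c * Ek * (P.mesh k ^ s / ((P.L : ℝ) ^ s - 1)) :=
        mul_le_mul_of_nonneg_left (sum_mesh_rpow_le hs hL k) (mul_nonneg hc hEk0)
    _ = _ := by rw [hEk]; ring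

end Top

/-! ## §3 Two (2.10)-bumps on two scales convolved over the sites of `T_ε`, and the scale algebra of a pair -/

section Pair

/-- **Two bumps on two scales**: `Σ_u exp(−δ(L^{j₁}ε)^{−1}ε|x−u|)·exp(−δ(L^{j₂}ε)^{−1}ε|u−y|) ≤ N(8d/δ)^d·(L^{min(j₁,j₂)})^d·exp(−(δ/2)(L^{max(j₁,j₂)}ε)^{−1}ε|x−y|)`
(`0 < δ ≤ 1`): the volume of the FINER scale, half the decay of the COARSER one (FILE E `conv2_le_max` on `T_ε × {1,…,N}` + `profile_half_scale_le`).
[cite: Balaban1983Higgs3, (2.6) p.424, (2.10) p.426] [cite: Balaban1983RegularityDecay, Sect. 5 Theorem p.594] -/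
theorem conv2_scales_le {δ : ℝ} (hδ : 0 < δ) (hδ1 : δ ≤ 1) (j₁ j₂ : ℕ) (x y : HiggsLattice.Site P 0) (i₀ : Ix N) :
    ∑ u : HiggsLattice.Site P 0,
        Real.exp (-(δ * (P.mesh j₁)⁻¹ * (P.mesh 0 * (HiggsLattice.Site.tdist x u : ℝ)))) *
          Real.exp (-(δ * (P.mesh j₂)⁻¹ * (P.mesh 0 * (HiggsLattice.Site.tdist u y : ℝ))))
      ≤ (nCol N : ℝ) * (8 * P.d / δ) ^ P.d * ((P.L : ℝ) ^ (min j₁ j₂)) ^ P.d *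
          Real.exp (-(δ / 2 * (P.mesh (max j₁ j₂))⁻¹ * (P.mesh 0 * (HiggsLattice.Site.tdist x y : ℝ)))) := by
  have hL1 : (1 : ℝ) ≤ (P.L : ℝ) := by exact_mod_cast P.hL
  simp only [rate_eq]
  set a : ℝ := δ / (P.L : ℝ) ^ j₁ with ha_def
  set b : ℝ := δ / (P.L : ℝ) ^ j₂ with hb_def
  have ha : 0 < a := by positivity
  have hb : 0 < b := by positivity
  -- pass to the sum over `T_ε × Ix`
  have h1 : ∑ u : HiggsLattice.Site P 0,
        Real.exp (-(a * (HiggsLattice.Site.tdist x u : ℝ))) * Real.exp (-(b * (HiggsLattice.Site.tdist u y : ℝ)))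
      ≤ ∑ s : HiggsLattice.Site P 0 × Ix N,
        Real.exp (-(a * (HiggsLattice.Site.tdist x s.1 : ℝ))) * Real.exp (-(b * (HiggsLattice.Site.tdist s.1 y : ℝ))) :=
    sum_site_le_sum_idx _ (fun u => by positivity) i₀
  refine h1.trans ((conv2_le_max ha hb x y i₀).trans ?_)
  -- identify `max a b`, `min a b` with the rates of the finer / coarser scale
  have rate_anti : ∀ {i j : ℕ}, i ≤ j → δ / (P.L : ℝ) ^ j ≤ δ / (P.L : ℝ) ^ i := fun {i j} hij =>
    div_le_div_of_nonneg_left hδ.le (by positivity) (pow_le_pow_right₀ hL1 hij)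
  have hmax : max a b = δ / (P.L : ℝ) ^ (min j₁ j₂) := by
    rcases le_total j₁ j₂ with h | h
    · rw [min_eq_left h, max_eq_left (rate_anti h)]
    · rw [min_eq_right h, max_eq_right (rate_anti h)]
  have hmin : min a b = δ / (P.L : ℝ) ^ (max j₁ j₂) := by
    rcases le_total j₁ j₂ with h | h
    · rw [max_eq_right h, min_eq_right (rate_anti h)]
    · rw [max_eq_left h, min_eq_left (rate_anti h)]
  rw [hmax, hmin]
  have hP := profile_half_scale_le (P := P) (N := N) hδ hδ1 (min j₁ j₂)
  have hrate : δ / (P.L : ℝ) ^ (max j₁ j₂) / 2 = δ / 2 / (P.L : ℝ) ^ (max j₁ j₂) := by ring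
  rw [hrate]
  exact mul_le_mul_of_nonneg_right hP (Real.exp_nonneg _)

/-- `min j₁ j₂ + max j₁ j₂ = j₁ + j₂`. [cite: Balaban1983Higgs3, (2.6) p.424] -/
theorem min_add_max' (j₁ j₂ : ℕ) : min j₁ j₂ + max j₁ j₂ = j₁ + j₂ := by omega

/-- **The scale algebra of a pair**: `(L^{j₁}ε)^{a₁−d}(L^{j₂}ε)^{a₂−d}(L^{min(j₁,j₂)})^d = (L^{j₁}ε)^{a₁}(L^{j₂}ε)^{a₂}·((L^{max(j₁,j₂)}ε)^d)^{−1}·(ε^d)^{−1}`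
— the volume of the finer scale against the two `(L^jε)^{−d}`'s leaves the `−d` of the coarser scale and one `ε^{−d}` (the matrix-entry
normalization of a kernel). [cite: Balaban1983Higgs3, (2.6) p.424, (2.10) p.426] -/
theorem pair_scale_algebra (j₁ j₂ : ℕ) (a₁ a₂ : ℝ) :
    P.mesh j₁ ^ (a₁ - (P.d : ℝ)) * P.mesh j₂ ^ (a₂ - (P.d : ℝ)) * ((P.L : ℝ) ^ (min j₁ j₂)) ^ P.d
      = P.mesh j₁ ^ a₁ * P.mesh j₂ ^ a₂ * (P.mesh (max j₁ j₂) ^ P.d)⁻¹ * (P.mesh 0 ^ P.d)⁻¹ := by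
  have hL0 : (0 : ℝ) < (P.L : ℝ) := by have := P.hL; positivity
  have hm0 : 0 < P.mesh 0 := P.mesh_pos 0
  have hsub : ∀ (j : ℕ) (a : ℝ), P.mesh j ^ (a - (P.d : ℝ)) = P.mesh j ^ a * (((P.L : ℝ) ^ j) ^ P.d * P.mesh 0 ^ P.d)⁻¹ := by
    intro j a
    rw [Real.rpow_sub (P.mesh_pos j), Real.rpow_natCast, div_eq_mul_inv,
      show P.mesh j = (P.L : ℝ) ^ j * P.mesh 0 by simp [HiggsLattice.Params.mesh], mul_pow]
  have hmesh : P.mesh (max j₁ j₂) ^ P.d = ((P.L : ℝ) ^ (max j₁ j₂)) ^ P.d * P.mesh 0 ^ P.d := by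
    rw [show P.mesh (max j₁ j₂) = (P.L : ℝ) ^ (max j₁ j₂) * P.mesh 0 by simp [HiggsLattice.Params.mesh], mul_pow]
  have h1 : ((P.L : ℝ) ^ j₁) ^ P.d ≠ 0 := by positivity
  have h2 : ((P.L : ℝ) ^ j₂) ^ P.d ≠ 0 := by positivity
  have h4 : ((P.L : ℝ) ^ (max j₁ j₂)) ^ P.d ≠ 0 := by positivity
  have h5 : P.mesh 0 ^ P.d ≠ 0 := by positivity
  have hpow : ((P.L : ℝ) ^ (min j₁ j₂)) ^ P.d * ((P.L : ℝ) ^ (max j₁ j₂)) ^ P.d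
      = ((P.L : ℝ) ^ j₁) ^ P.d * ((P.L : ℝ) ^ j₂) ^ P.d := by
    rw [← mul_pow, ← pow_add, min_add_max', pow_add, mul_pow]
  have hmin : ((P.L : ℝ) ^ (min j₁ j₂)) ^ P.d
      = ((P.L : ℝ) ^ j₁) ^ P.d * ((P.L : ℝ) ^ j₂) ^ P.d * (((P.L : ℝ) ^ (max j₁ j₂)) ^ P.d)⁻¹ := by
    rw [← hpow]; field_simp
  rw [hsub, hsub, hmesh, hmin]
  field_simp

end Pair

/-! ## §4 Regrouping a double scale sum by its larger index; the inner geometric sums -/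

section Regroup

/-- **A double sum over a square of scales is below the sum of its two triangles** (nonnegative terms; the diagonal is counted twice):
`Σ_{j₁<k}Σ_{j₂<k} g ≤ Σ_{j₁<k}Σ_{j₂≤j₁} g + Σ_{j₂<k}Σ_{j₁≤j₂} g` — each pair is filed under its LARGER index. [cite: Balaban1983Higgs3, (2.6) p.424] -/
theorem sum_sq_le_lower_add_upper (k : ℕ) (g : ℕ → ℕ → ℝ) (hg : ∀ i j, 0 ≤ g i j) :
    ∑ j₁ ∈ Finset.range k, ∑ j₂ ∈ Finset.range k, g j₁ j₂
      ≤ (∑ j₁ ∈ Finset.range k, ∑ j₂ ∈ Finset.range (j₁ + 1), g j₁ j₂)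
        + ∑ j₂ ∈ Finset.range k, ∑ j₁ ∈ Finset.range (j₂ + 1), g j₁ j₂ := by
  classical
  have hsplit : ∀ j₁, ∑ j₂ ∈ Finset.range k, g j₁ j₂
      = (∑ j₂ ∈ (Finset.range k).filter (fun j₂ => j₂ ≤ j₁), g j₁ j₂)
        + ∑ j₂ ∈ (Finset.range k).filter (fun j₂ => ¬ j₂ ≤ j₁), g j₁ j₂ :=
    fun j₁ => (Finset.sum_filter_add_sum_filter_not _ _ _).symm
  have hlow : ∀ j₁, ∑ j₂ ∈ (Finset.range k).filter (fun j₂ => j₂ ≤ j₁), g j₁ j₂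
      ≤ ∑ j₂ ∈ Finset.range (j₁ + 1), g j₁ j₂ := by
    intro j₁
    refine Finset.sum_le_sum_of_subset_of_nonneg ?_ (fun j _ _ => hg _ _)
    intro j hj
    simp only [Finset.mem_filter, Finset.mem_range] at hj ⊢
    omega
  have hcomm : ∑ j₁ ∈ Finset.range k, ∑ j₂ ∈ (Finset.range k).filter (fun j₂ => ¬ j₂ ≤ j₁), g j₁ j₂
      = ∑ j₂ ∈ Finset.range k, ∑ j₁ ∈ (Finset.range k).filter (fun j₁ => j₁ < j₂), g j₁ j₂ := by
    refine Finset.sum_comm' ?_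
    intro j₁ j₂
    simp only [Finset.mem_filter, Finset.mem_range]
    omega
  have hup : ∀ j₂, ∑ j₁ ∈ (Finset.range k).filter (fun j₁ => j₁ < j₂), g j₁ j₂
      ≤ ∑ j₁ ∈ Finset.range (j₂ + 1), g j₁ j₂ := by
    intro j₂
    refine Finset.sum_le_sum_of_subset_of_nonneg ?_ (fun j _ _ => hg _ _)
    intro j hj
    simp only [Finset.mem_filter, Finset.mem_range] at hj ⊢
    omega
  calc ∑ j₁ ∈ Finset.range k, ∑ j₂ ∈ Finset.range k, g j₁ j₂
      = ∑ j₁ ∈ Finset.range k, ((∑ j₂ ∈ (Finset.range k).filter (fun j₂ => j₂ ≤ j₁), g j₁ j₂)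
        + ∑ j₂ ∈ (Finset.range k).filter (fun j₂ => ¬ j₂ ≤ j₁), g j₁ j₂) :=
        Finset.sum_congr rfl fun j₁ _ => hsplit j₁
    _ = (∑ j₁ ∈ Finset.range k, ∑ j₂ ∈ (Finset.range k).filter (fun j₂ => j₂ ≤ j₁), g j₁ j₂)
        + ∑ j₁ ∈ Finset.range k, ∑ j₂ ∈ (Finset.range k).filter (fun j₂ => ¬ j₂ ≤ j₁), g j₁ j₂ :=
        Finset.sum_add_distrib
    _ ≤ _ := by
        rw [hcomm]
        exact add_le_add (Finset.sum_le_sum fun j₁ _ => hlow j₁) (Finset.sum_le_sum fun j₂ _ => hup j₂)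

/-- **The inner geometric sum over the finer index**: `Σ_{j′≤j}(L^{j′}ε)^a ≤ L^a(L^a − 1)^{−1}·(L^jε)^a` for `a > 0`, `L > 1`
(FILE E `sum_mesh_rpow_le` up to `j + 1`). [cite: Balaban1983Higgs3, (2.6) p.424, (2.10) p.426] -/
theorem sum_range_succ_mesh_rpow_le (hL : 1 < P.L) {a : ℝ} (ha : 0 < a) (j : ℕ) :
    ∑ j' ∈ Finset.range (j + 1), P.mesh j' ^ a ≤ (P.L : ℝ) ^ a / ((P.L : ℝ) ^ a - 1) * P.mesh j ^ a := by
  have hL0 : (0 : ℝ) ≤ (P.L : ℝ) := Nat.cast_nonneg _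
  have h1 := sum_mesh_rpow_le (P := P) ha hL (j + 1)
  have h2 : P.mesh (j + 1) ^ a = (P.L : ℝ) ^ a * P.mesh j ^ a := by
    rw [mesh_succ, Real.mul_rpow hL0 (P.mesh_pos j).le]
  rw [h2] at h1
  refine h1.trans (le_of_eq ?_)
  ring

end Regroup

/-! ## §5 CLOSURE UNDER CONVOLUTION: two majorants convolved are a majorant (exponents add, rate halves) -/

section Closure

/-- **CLOSURE OF THE MAJORANT CURRENCY UNDER LATTICE CONVOLUTION.**  For exponents `a₁, a₂ > 0` (NO condition on `a₁ + a₂` versus `d`),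
`0 < δ ≤ 1`, `L > 1`:
`Σ_u 𝔪(c₁,a₁;δ)(x,u)·𝔪(c₂,a₂;δ)(u,y) ≤ 𝔪(c₁c₂·N(8d/δ)^d(ε^d)^{−1}(L^{a₁}(L^{a₁}−1)^{−1} + L^{a₂}(L^{a₂}−1)^{−1}), a₁ + a₂; δ/2)(x,y)` —
each pair of scales costs the volume of the finer scale and keeps half the decay of the coarser one (§3), the pair is filed under its coarser
scale (§4) and the finer index is summed geometrically; hence chains of ANY length stay in the currency, one contraction at a time.
[cite: Balaban1983Higgs3, (1.16) p.414, (2.6) p.424, (2.10) p.426] [cite: Balaban1983RegularityDecay, Sect. 5 Theorem p.594] -/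
theorem conv_majorant_le (hL : 1 < P.L) {k : ℕ} {δ : ℝ} (hδ : 0 < δ) (hδ1 : δ ≤ 1) {a₁ a₂ c₁ c₂ : ℝ}
    (ha₁ : 0 < a₁) (ha₂ : 0 < a₂) (hc₁ : 0 ≤ c₁) (hc₂ : 0 ≤ c₂) (i₀ : Ix N) (x y : HiggsLattice.Site P 0) :
    ∑ u : HiggsLattice.Site P 0,
        (∑ j ∈ Finset.range k, c₁ * P.mesh j ^ (a₁ - (P.d : ℝ)) *
            Real.exp (-(δ * (P.mesh j)⁻¹ * (P.mesh 0 * (HiggsLattice.Site.tdist x u : ℝ))))) *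
        (∑ j ∈ Finset.range k, c₂ * P.mesh j ^ (a₂ - (P.d : ℝ)) *
            Real.exp (-(δ * (P.mesh j)⁻¹ * (P.mesh 0 * (HiggsLattice.Site.tdist u y : ℝ)))))
      ≤ ∑ j ∈ Finset.range k, (c₁ * c₂ * ((nCol N : ℝ) * (8 * P.d / δ) ^ P.d * (P.mesh 0 ^ P.d)⁻¹ *
            ((P.L : ℝ) ^ a₁ / ((P.L : ℝ) ^ a₁ - 1) + (P.L : ℝ) ^ a₂ / ((P.L : ℝ) ^ a₂ - 1)))) *
          P.mesh j ^ (a₁ + a₂ - (P.d : ℝ)) *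
          Real.exp (-(δ / 2 * (P.mesh j)⁻¹ * (P.mesh 0 * (HiggsLattice.Site.tdist x y : ℝ)))) := by
  have hL1 : (1 : ℝ) < (P.L : ℝ) := by exact_mod_cast hL
  have hL0 : (0 : ℝ) ≤ (P.L : ℝ) := Nat.cast_nonneg _
  have hm : ∀ j, 0 < P.mesh j := P.mesh_pos
  -- abbreviations
  set E : ℕ → HiggsLattice.Site P 0 → HiggsLattice.Site P 0 → ℝ :=
    fun j u v => Real.exp (-(δ * (P.mesh j)⁻¹ * (P.mesh 0 * (HiggsLattice.Site.tdist u v : ℝ)))) with hE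
  set E2 : ℕ → ℝ := fun j => Real.exp (-(δ / 2 * (P.mesh j)⁻¹ * (P.mesh 0 * (HiggsLattice.Site.tdist x y : ℝ)))) with hE2
  have hE20 : ∀ j, 0 ≤ E2 j := fun j => Real.exp_nonneg _
  set K₀ : ℝ := (nCol N : ℝ) * (8 * P.d / δ) ^ P.d with hK₀
  have hK₀0 : 0 ≤ K₀ := by rw [hK₀]; positivity
  set G₁ : ℝ := (P.L : ℝ) ^ a₁ / ((P.L : ℝ) ^ a₁ - 1) with hG₁
  set G₂ : ℝ := (P.L : ℝ) ^ a₂ / ((P.L : ℝ) ^ a₂ - 1) with hG₂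
  have hG₁0 : 0 ≤ G₁ := by
    have := Real.one_lt_rpow hL1 ha₁; rw [hG₁]; exact div_nonneg (by linarith) (by linarith)
  have hG₂0 : 0 ≤ G₂ := by
    have := Real.one_lt_rpow hL1 ha₂; rw [hG₂]; exact div_nonneg (by linarith) (by linarith)
  -- the pair term after the site sum
  set g : ℕ → ℕ → ℝ := fun j₁ j₂ => P.mesh j₁ ^ a₁ * P.mesh j₂ ^ a₂ * (P.mesh (max j₁ j₂) ^ P.d)⁻¹ * E2 (max j₁ j₂) with hg
  have hg0 : ∀ j₁ j₂, 0 ≤ g j₁ j₂ := fun j₁ j₂ => by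
    rw [hg]
    exact mul_nonneg (mul_nonneg (mul_nonneg (Real.rpow_nonneg (hm j₁).le _) (Real.rpow_nonneg (hm j₂).le _))
      (inv_nonneg.mpr (pow_nonneg (hm _).le _))) (hE20 _)
  -- Step 1: expand the two scale sums and bring the site sum inside
  have step1 : ∑ u : HiggsLattice.Site P 0,
        (∑ j ∈ Finset.range k, c₁ * P.mesh j ^ (a₁ - (P.d : ℝ)) * E j x u) *
        (∑ j ∈ Finset.range k, c₂ * P.mesh j ^ (a₂ - (P.d : ℝ)) * E j u y)
      = ∑ j₁ ∈ Finset.range k, ∑ j₂ ∈ Finset.range k,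
          c₁ * c₂ * (P.mesh j₁ ^ (a₁ - (P.d : ℝ)) * P.mesh j₂ ^ (a₂ - (P.d : ℝ))) *
            ∑ u : HiggsLattice.Site P 0, E j₁ x u * E j₂ u y := by
    calc ∑ u : HiggsLattice.Site P 0,
          (∑ j ∈ Finset.range k, c₁ * P.mesh j ^ (a₁ - (P.d : ℝ)) * E j x u) *
          (∑ j ∈ Finset.range k, c₂ * P.mesh j ^ (a₂ - (P.d : ℝ)) * E j u y)
        = ∑ u : HiggsLattice.Site P 0, ∑ j₁ ∈ Finset.range k, ∑ j₂ ∈ Finset.range k,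
            c₁ * c₂ * (P.mesh j₁ ^ (a₁ - (P.d : ℝ)) * P.mesh j₂ ^ (a₂ - (P.d : ℝ))) * (E j₁ x u * E j₂ u y) := by
          refine Finset.sum_congr rfl fun u _ => ?_
          rw [Finset.sum_mul_sum]
          refine Finset.sum_congr rfl fun j₁ _ => Finset.sum_congr rfl fun j₂ _ => ?_
          ring
      _ = ∑ j₁ ∈ Finset.range k, ∑ u : HiggsLattice.Site P 0, ∑ j₂ ∈ Finset.range k,
            c₁ * c₂ * (P.mesh j₁ ^ (a₁ - (P.d : ℝ)) * P.mesh j₂ ^ (a₂ - (P.d : ℝ))) * (E j₁ x u * E j₂ u y) :=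
          Finset.sum_comm
      _ = ∑ j₁ ∈ Finset.range k, ∑ j₂ ∈ Finset.range k, ∑ u : HiggsLattice.Site P 0,
            c₁ * c₂ * (P.mesh j₁ ^ (a₁ - (P.d : ℝ)) * P.mesh j₂ ^ (a₂ - (P.d : ℝ))) * (E j₁ x u * E j₂ u y) :=
          Finset.sum_congr rfl fun j₁ _ => Finset.sum_comm
      _ = _ := by
          refine Finset.sum_congr rfl fun j₁ _ => Finset.sum_congr rfl fun j₂ _ => ?_
          rw [Finset.mul_sum]
  -- Step 2: each pair of scales
  have step2 : ∀ j₁ j₂ : ℕ,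
      c₁ * c₂ * (P.mesh j₁ ^ (a₁ - (P.d : ℝ)) * P.mesh j₂ ^ (a₂ - (P.d : ℝ))) *
          ∑ u : HiggsLattice.Site P 0, E j₁ x u * E j₂ u y
        ≤ c₁ * c₂ * K₀ * (P.mesh 0 ^ P.d)⁻¹ * g j₁ j₂ := by
    intro j₁ j₂
    have hconv := conv2_scales_le (P := P) (N := N) hδ hδ1 j₁ j₂ x y i₀
    have hpre : 0 ≤ c₁ * c₂ * (P.mesh j₁ ^ (a₁ - (P.d : ℝ)) * P.mesh j₂ ^ (a₂ - (P.d : ℝ))) :=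
      mul_nonneg (mul_nonneg hc₁ hc₂) (mul_nonneg (Real.rpow_nonneg (hm j₁).le _) (Real.rpow_nonneg (hm j₂).le _))
    calc c₁ * c₂ * (P.mesh j₁ ^ (a₁ - (P.d : ℝ)) * P.mesh j₂ ^ (a₂ - (P.d : ℝ))) *
          ∑ u : HiggsLattice.Site P 0, E j₁ x u * E j₂ u y
        ≤ c₁ * c₂ * (P.mesh j₁ ^ (a₁ - (P.d : ℝ)) * P.mesh j₂ ^ (a₂ - (P.d : ℝ))) *
            (K₀ * ((P.L : ℝ) ^ (min j₁ j₂)) ^ P.d * E2 (max j₁ j₂)) := mul_le_mul_of_nonneg_left hconv hpre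
      _ = c₁ * c₂ * K₀ * (P.mesh j₁ ^ (a₁ - (P.d : ℝ)) * P.mesh j₂ ^ (a₂ - (P.d : ℝ)) * ((P.L : ℝ) ^ (min j₁ j₂)) ^ P.d) *
            E2 (max j₁ j₂) := by ring
      _ = c₁ * c₂ * K₀ * (P.mesh j₁ ^ a₁ * P.mesh j₂ ^ a₂ * (P.mesh (max j₁ j₂) ^ P.d)⁻¹ * (P.mesh 0 ^ P.d)⁻¹) *
            E2 (max j₁ j₂) := by rw [pair_scale_algebra]
      _ = c₁ * c₂ * K₀ * (P.mesh 0 ^ P.d)⁻¹ * g j₁ j₂ := by rw [hg]; ring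
  -- Step 3: the lower triangle (`j₂ ≤ j₁`: the pair lives at the scale `j₁`)
  have step3 : ∀ j₁ : ℕ, ∑ j₂ ∈ Finset.range (j₁ + 1), g j₁ j₂
      ≤ G₂ * (P.mesh j₁ ^ (a₁ + a₂ - (P.d : ℝ)) * E2 j₁) := by
    intro j₁
    have hmax : ∀ j₂ ∈ Finset.range (j₁ + 1), g j₁ j₂ = P.mesh j₁ ^ a₁ * (P.mesh j₁ ^ P.d)⁻¹ * E2 j₁ * P.mesh j₂ ^ a₂ := by
      intro j₂ hj₂
      have h : max j₁ j₂ = j₁ := max_eq_left (by have := Finset.mem_range.1 hj₂; omega)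
      rw [hg]; simp only [h]; ring
    rw [Finset.sum_congr rfl hmax, ← Finset.mul_sum]
    have hpre : 0 ≤ P.mesh j₁ ^ a₁ * (P.mesh j₁ ^ P.d)⁻¹ * E2 j₁ :=
      mul_nonneg (mul_nonneg (Real.rpow_nonneg (hm j₁).le _) (inv_nonneg.mpr (pow_nonneg (hm _).le _))) (hE20 _)
    calc P.mesh j₁ ^ a₁ * (P.mesh j₁ ^ P.d)⁻¹ * E2 j₁ * ∑ j₂ ∈ Finset.range (j₁ + 1), P.mesh j₂ ^ a₂
        ≤ P.mesh j₁ ^ a₁ * (P.mesh j₁ ^ P.d)⁻¹ * E2 j₁ * (G₂ * P.mesh j₁ ^ a₂) :=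
          mul_le_mul_of_nonneg_left (sum_range_succ_mesh_rpow_le hL ha₂ j₁) hpre
      _ = G₂ * ((P.mesh j₁ ^ a₁ * P.mesh j₁ ^ a₂ * (P.mesh j₁ ^ P.d)⁻¹) * E2 j₁) := by ring
      _ = G₂ * (P.mesh j₁ ^ (a₁ + a₂ - (P.d : ℝ)) * E2 j₁) := by
          rw [mesh_rpow_add, Real.rpow_sub (hm j₁), Real.rpow_natCast, div_eq_mul_inv]
  -- Step 4: the upper triangle (`j₁ ≤ j₂`: the pair lives at the scale `j₂`)
  have step4 : ∀ j₂ : ℕ, ∑ j₁ ∈ Finset.range (j₂ + 1), g j₁ j₂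
      ≤ G₁ * (P.mesh j₂ ^ (a₁ + a₂ - (P.d : ℝ)) * E2 j₂) := by
    intro j₂
    have hmax : ∀ j₁ ∈ Finset.range (j₂ + 1), g j₁ j₂ = P.mesh j₂ ^ a₂ * (P.mesh j₂ ^ P.d)⁻¹ * E2 j₂ * P.mesh j₁ ^ a₁ := by
      intro j₁ hj₁
      have h : max j₁ j₂ = j₂ := max_eq_right (by have := Finset.mem_range.1 hj₁; omega)
      rw [hg]; simp only [h]; ring
    rw [Finset.sum_congr rfl hmax, ← Finset.mul_sum]
    have hpre : 0 ≤ P.mesh j₂ ^ a₂ * (P.mesh j₂ ^ P.d)⁻¹ * E2 j₂ :=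
      mul_nonneg (mul_nonneg (Real.rpow_nonneg (hm j₂).le _) (inv_nonneg.mpr (pow_nonneg (hm _).le _))) (hE20 _)
    calc P.mesh j₂ ^ a₂ * (P.mesh j₂ ^ P.d)⁻¹ * E2 j₂ * ∑ j₁ ∈ Finset.range (j₂ + 1), P.mesh j₁ ^ a₁
        ≤ P.mesh j₂ ^ a₂ * (P.mesh j₂ ^ P.d)⁻¹ * E2 j₂ * (G₁ * P.mesh j₂ ^ a₁) :=
          mul_le_mul_of_nonneg_left (sum_range_succ_mesh_rpow_le hL ha₁ j₂) hpre
      _ = G₁ * ((P.mesh j₂ ^ a₁ * P.mesh j₂ ^ a₂ * (P.mesh j₂ ^ P.d)⁻¹) * E2 j₂) := by ring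
      _ = G₁ * (P.mesh j₂ ^ (a₁ + a₂ - (P.d : ℝ)) * E2 j₂) := by
          rw [mesh_rpow_add, Real.rpow_sub (hm j₂), Real.rpow_natCast, div_eq_mul_inv]
  -- Step 5: assemble
  have hpre : 0 ≤ c₁ * c₂ * K₀ * (P.mesh 0 ^ P.d)⁻¹ :=
    mul_nonneg (mul_nonneg (mul_nonneg hc₁ hc₂) hK₀0) (inv_nonneg.mpr (pow_nonneg (hm 0).le _))
  calc ∑ u : HiggsLattice.Site P 0,
        (∑ j ∈ Finset.range k, c₁ * P.mesh j ^ (a₁ - (P.d : ℝ)) * E j x u) *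
        (∑ j ∈ Finset.range k, c₂ * P.mesh j ^ (a₂ - (P.d : ℝ)) * E j u y)
      = _ := step1
    _ ≤ ∑ j₁ ∈ Finset.range k, ∑ j₂ ∈ Finset.range k, c₁ * c₂ * K₀ * (P.mesh 0 ^ P.d)⁻¹ * g j₁ j₂ :=
        Finset.sum_le_sum fun j₁ _ => Finset.sum_le_sum fun j₂ _ => step2 j₁ j₂
    _ = c₁ * c₂ * K₀ * (P.mesh 0 ^ P.d)⁻¹ * ∑ j₁ ∈ Finset.range k, ∑ j₂ ∈ Finset.range k, g j₁ j₂ := by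
        simp_rw [Finset.mul_sum]
    _ ≤ c₁ * c₂ * K₀ * (P.mesh 0 ^ P.d)⁻¹ *
          ((∑ j₁ ∈ Finset.range k, ∑ j₂ ∈ Finset.range (j₁ + 1), g j₁ j₂)
            + ∑ j₂ ∈ Finset.range k, ∑ j₁ ∈ Finset.range (j₂ + 1), g j₁ j₂) :=
        mul_le_mul_of_nonneg_left (sum_sq_le_lower_add_upper k g hg0) hpre
    _ ≤ c₁ * c₂ * K₀ * (P.mesh 0 ^ P.d)⁻¹ *
          ((∑ j₁ ∈ Finset.range k, G₂ * (P.mesh j₁ ^ (a₁ + a₂ - (P.d : ℝ)) * E2 j₁))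
            + ∑ j₂ ∈ Finset.range k, G₁ * (P.mesh j₂ ^ (a₁ + a₂ - (P.d : ℝ)) * E2 j₂)) :=
        mul_le_mul_of_nonneg_left (add_le_add (Finset.sum_le_sum fun j₁ _ => step3 j₁)
          (Finset.sum_le_sum fun j₂ _ => step4 j₂)) hpre
    _ = ∑ j ∈ Finset.range k, (c₁ * c₂ * (K₀ * (P.mesh 0 ^ P.d)⁻¹ * (G₁ + G₂))) *
          P.mesh j ^ (a₁ + a₂ - (P.d : ℝ)) * E2 j := by
        rw [← Finset.sum_add_distrib, Finset.mul_sum]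
        exact Finset.sum_congr rfl fun j _ => by ring
    _ = _ := by rw [hK₀, hG₁, hG₂]

end Closure

/-! ## §6 Kernel forms: two nonnegative kernels majorized in the currency, over sites and over bonds -/

section Kernels

/-- **Two kernels contracted over the sites**: if `0 ≤ F(u) ≤ 𝔪(c₁,a₁;δ)(x,u)` and `0 ≤ G(u) ≤ 𝔪(c₂,a₂;δ)(u,y)` (`a₁, a₂ > 0`), then
`Σ_u F(u)G(u) ≤ 𝔪(c₁c₂K(ε^d)^{−1}(…), a₁+a₂; δ/2)(x,y)` (§5) — the output is again a kernel majorized in the currency, ready for the next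
contraction. [cite: Balaban1983Higgs3, (1.16) p.414, (2.6) p.424, (2.10) p.426] -/
theorem sum_kernel_mul_le (hL : 1 < P.L) {k : ℕ} {δ : ℝ} (hδ : 0 < δ) (hδ1 : δ ≤ 1) {a₁ a₂ c₁ c₂ : ℝ}
    (ha₁ : 0 < a₁) (ha₂ : 0 < a₂) (hc₁ : 0 ≤ c₁) (hc₂ : 0 ≤ c₂) (i₀ : Ix N) (x y : HiggsLattice.Site P 0)
    (F G : HiggsLattice.Site P 0 → ℝ) (hF0 : ∀ u, 0 ≤ F u) (hG0 : ∀ u, 0 ≤ G u)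
    (hF : ∀ u, F u ≤ ∑ j ∈ Finset.range k, c₁ * P.mesh j ^ (a₁ - (P.d : ℝ)) *
      Real.exp (-(δ * (P.mesh j)⁻¹ * (P.mesh 0 * (HiggsLattice.Site.tdist x u : ℝ)))))
    (hG : ∀ u, G u ≤ ∑ j ∈ Finset.range k, c₂ * P.mesh j ^ (a₂ - (P.d : ℝ)) *
      Real.exp (-(δ * (P.mesh j)⁻¹ * (P.mesh 0 * (HiggsLattice.Site.tdist u y : ℝ))))) :
    ∑ u : HiggsLattice.Site P 0, F u * G u
      ≤ ∑ j ∈ Finset.range k, (c₁ * c₂ * ((nCol N : ℝ) * (8 * P.d / δ) ^ P.d * (P.mesh 0 ^ P.d)⁻¹ *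
            ((P.L : ℝ) ^ a₁ / ((P.L : ℝ) ^ a₁ - 1) + (P.L : ℝ) ^ a₂ / ((P.L : ℝ) ^ a₂ - 1)))) *
          P.mesh j ^ (a₁ + a₂ - (P.d : ℝ)) *
          Real.exp (-(δ / 2 * (P.mesh j)⁻¹ * (P.mesh 0 * (HiggsLattice.Site.tdist x y : ℝ)))) := by
  refine le_trans (Finset.sum_le_sum fun u _ => ?_) (conv_majorant_le hL hδ hδ1 ha₁ ha₂ hc₁ hc₂ i₀ x y)
  exact mul_le_mul (hF u) (hG u) (hG0 u) ((hF0 u).trans (hF u))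

/-- **Two kernels contracted over the BONDS of `T_ε`** (the sources of `V_k` run over bonds; majorants read at the base point `b₋ = b.src`):
`Σ_b F(b)G(b) ≤ d·𝔪(c₁c₂K(ε^d)^{−1}(…), a₁+a₂; δ/2)(x,y)` — bonds = sites × `d` directions (`HiggsCovariancePos.sum_site_dir`).
[cite: Balaban1983Higgs3, (1.16) p.414, (2.6) p.424, (2.10) p.426] [cite: Balaban1982Higgs1, (1.4) p.604] -/
theorem sum_bond_kernel_mul_le (hL : 1 < P.L) {k : ℕ} {δ : ℝ} (hδ : 0 < δ) (hδ1 : δ ≤ 1) {a₁ a₂ c₁ c₂ : ℝ}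
    (ha₁ : 0 < a₁) (ha₂ : 0 < a₂) (hc₁ : 0 ≤ c₁) (hc₂ : 0 ≤ c₂) (i₀ : Ix N) (x y : HiggsLattice.Site P 0)
    (F G : HiggsLattice.PBond P 0 → ℝ) (hF0 : ∀ b, 0 ≤ F b) (hG0 : ∀ b, 0 ≤ G b)
    (hF : ∀ b, F b ≤ ∑ j ∈ Finset.range k, c₁ * P.mesh j ^ (a₁ - (P.d : ℝ)) *
      Real.exp (-(δ * (P.mesh j)⁻¹ * (P.mesh 0 * (HiggsLattice.Site.tdist x b.src : ℝ)))))
    (hG : ∀ b, G b ≤ ∑ j ∈ Finset.range k, c₂ * P.mesh j ^ (a₂ - (P.d : ℝ)) *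
      Real.exp (-(δ * (P.mesh j)⁻¹ * (P.mesh 0 * (HiggsLattice.Site.tdist b.src y : ℝ))))) :
    ∑ b : HiggsLattice.PBond P 0, F b * G b
      ≤ (P.d : ℝ) * ∑ j ∈ Finset.range k, (c₁ * c₂ * ((nCol N : ℝ) * (8 * P.d / δ) ^ P.d * (P.mesh 0 ^ P.d)⁻¹ *
            ((P.L : ℝ) ^ a₁ / ((P.L : ℝ) ^ a₁ - 1) + (P.L : ℝ) ^ a₂ / ((P.L : ℝ) ^ a₂ - 1)))) *
          P.mesh j ^ (a₁ + a₂ - (P.d : ℝ)) *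
          Real.exp (-(δ / 2 * (P.mesh j)⁻¹ * (P.mesh 0 * (HiggsLattice.Site.tdist x y : ℝ)))) := by
  -- abbreviate the two majorants as functions of the base point
  set M₁ : HiggsLattice.Site P 0 → ℝ := fun u => ∑ j ∈ Finset.range k, c₁ * P.mesh j ^ (a₁ - (P.d : ℝ)) *
      Real.exp (-(δ * (P.mesh j)⁻¹ * (P.mesh 0 * (HiggsLattice.Site.tdist x u : ℝ)))) with hM₁
  set M₂ : HiggsLattice.Site P 0 → ℝ := fun u => ∑ j ∈ Finset.range k, c₂ * P.mesh j ^ (a₂ - (P.d : ℝ)) *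
      Real.exp (-(δ * (P.mesh j)⁻¹ * (P.mesh 0 * (HiggsLattice.Site.tdist u y : ℝ)))) with hM₂
  have hM₂0 : ∀ u, 0 ≤ M₂ u := fun u => majorant_nonneg hc₂ u y
  have hFb : ∀ b : HiggsLattice.PBond P 0, F b ≤ M₁ b.src := hF
  have hGb : ∀ b : HiggsLattice.PBond P 0, G b ≤ M₂ b.src := hG
  -- bonds = sites × directions
  have hsd := sum_site_dir (P := P) (k := 0) (fun u (_μ : Fin P.d) => M₁ u * M₂ u)
  have hd : ∑ u : HiggsLattice.Site P 0, ∑ _μ : Fin P.d, M₁ u * M₂ u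
      = (P.d : ℝ) * ∑ u : HiggsLattice.Site P 0, M₁ u * M₂ u := by
    rw [Finset.mul_sum]
    refine Finset.sum_congr rfl fun u _ => ?_
    simp only [Finset.sum_const, Finset.card_univ, Fintype.card_fin, nsmul_eq_mul]
  calc ∑ b : HiggsLattice.PBond P 0, F b * G b
      ≤ ∑ b : HiggsLattice.PBond P 0, M₁ b.src * M₂ b.src :=
        Finset.sum_le_sum fun b _ => mul_le_mul (hFb b) (hGb b) (hG0 b) ((hF0 b).trans (hFb b))
    _ = (P.d : ℝ) * ∑ u : HiggsLattice.Site P 0, M₁ u * M₂ u := by rw [← hsd, hd]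
    _ ≤ _ := by
        refine mul_le_mul_of_nonneg_left ?_ (Nat.cast_nonneg _)
        exact sum_kernel_mul_le hL hδ hδ1 ha₁ ha₂ hc₁ hc₂ i₀ x y M₁ M₂ (fun u => majorant_nonneg hc₁ x u) hM₂0
          (fun u => le_rfl) (fun u => le_rfl)

end Kernels

/-! ## §7 Two kernels with total exponent above `d`: the contracted kernel is a single top-scale bump -/

section Chain2

/-- **The two-kernel chain with `a₁ + a₂ > d`**: `Σ_u F(u)G(u) ≤ c₁c₂K(ε^d)^{−1}(…)(L^{a₁+a₂−d} − 1)^{−1}·(L^kε)^{a₁+a₂−d}·exp(−(δ/2)(L^kε)^{−1}ε|x−y|)`,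
UNIFORMLY in `k` (§6 then §2). [cite: Balaban1983Higgs3, (1.16) p.414, (2.6) p.424, (2.10) p.426] -/
theorem chain2_le (hL : 1 < P.L) {k : ℕ} {δ : ℝ} (hδ : 0 < δ) (hδ1 : δ ≤ 1) {a₁ a₂ c₁ c₂ : ℝ}
    (ha₁ : 0 < a₁) (ha₂ : 0 < a₂) (hsum : (P.d : ℝ) < a₁ + a₂) (hc₁ : 0 ≤ c₁) (hc₂ : 0 ≤ c₂) (i₀ : Ix N)
    (x y : HiggsLattice.Site P 0) (F G : HiggsLattice.Site P 0 → ℝ) (hF0 : ∀ u, 0 ≤ F u) (hG0 : ∀ u, 0 ≤ G u)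
    (hF : ∀ u, F u ≤ ∑ j ∈ Finset.range k, c₁ * P.mesh j ^ (a₁ - (P.d : ℝ)) *
      Real.exp (-(δ * (P.mesh j)⁻¹ * (P.mesh 0 * (HiggsLattice.Site.tdist x u : ℝ)))))
    (hG : ∀ u, G u ≤ ∑ j ∈ Finset.range k, c₂ * P.mesh j ^ (a₂ - (P.d : ℝ)) *
      Real.exp (-(δ * (P.mesh j)⁻¹ * (P.mesh 0 * (HiggsLattice.Site.tdist u y : ℝ))))) :
    ∑ u : HiggsLattice.Site P 0, F u * G u
      ≤ (c₁ * c₂ * ((nCol N : ℝ) * (8 * P.d / δ) ^ P.d * (P.mesh 0 ^ P.d)⁻¹ *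
            ((P.L : ℝ) ^ a₁ / ((P.L : ℝ) ^ a₁ - 1) + (P.L : ℝ) ^ a₂ / ((P.L : ℝ) ^ a₂ - 1)))) /
          ((P.L : ℝ) ^ (a₁ + a₂ - (P.d : ℝ)) - 1) * P.mesh k ^ (a₁ + a₂ - (P.d : ℝ)) *
          Real.exp (-(δ / 2 * (P.mesh k)⁻¹ * (P.mesh 0 * (HiggsLattice.Site.tdist x y : ℝ)))) := by
  have hL1 : (1 : ℝ) < (P.L : ℝ) := by exact_mod_cast hL
  have hG₁0 : 0 ≤ (P.L : ℝ) ^ a₁ / ((P.L : ℝ) ^ a₁ - 1) := by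
    have := Real.one_lt_rpow hL1 ha₁; exact div_nonneg (by linarith) (by linarith)
  have hG₂0 : 0 ≤ (P.L : ℝ) ^ a₂ / ((P.L : ℝ) ^ a₂ - 1) := by
    have := Real.one_lt_rpow hL1 ha₂; exact div_nonneg (by linarith) (by linarith)
  have hc : 0 ≤ c₁ * c₂ * ((nCol N : ℝ) * (8 * P.d / δ) ^ P.d * (P.mesh 0 ^ P.d)⁻¹ *
      ((P.L : ℝ) ^ a₁ / ((P.L : ℝ) ^ a₁ - 1) + (P.L : ℝ) ^ a₂ / ((P.L : ℝ) ^ a₂ - 1))) := by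
    have := inv_nonneg.mpr (pow_nonneg (P.mesh_pos 0).le P.d)
    positivity
  exact (sum_kernel_mul_le hL hδ hδ1 ha₁ ha₂ hc₁ hc₂ i₀ x y F G hF0 hG0 hF hG).trans
    (majorant_le_top hL hc (by linarith) (by linarith) x y)

/-- **The two-kernel chain over bonds** (majorants at the base points): the same bound times `d`.
[cite: Balaban1983Higgs3, (1.16) p.414, (2.6) p.424, (2.10) p.426] [cite: Balaban1982Higgs1, (1.4) p.604] -/
theorem bond_chain2_le (hL : 1 < P.L) {k : ℕ} {δ : ℝ} (hδ : 0 < δ) (hδ1 : δ ≤ 1) {a₁ a₂ c₁ c₂ : ℝ}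
    (ha₁ : 0 < a₁) (ha₂ : 0 < a₂) (hsum : (P.d : ℝ) < a₁ + a₂) (hc₁ : 0 ≤ c₁) (hc₂ : 0 ≤ c₂) (i₀ : Ix N)
    (x y : HiggsLattice.Site P 0) (F G : HiggsLattice.PBond P 0 → ℝ) (hF0 : ∀ b, 0 ≤ F b) (hG0 : ∀ b, 0 ≤ G b)
    (hF : ∀ b, F b ≤ ∑ j ∈ Finset.range k, c₁ * P.mesh j ^ (a₁ - (P.d : ℝ)) *
      Real.exp (-(δ * (P.mesh j)⁻¹ * (P.mesh 0 * (HiggsLattice.Site.tdist x b.src : ℝ)))))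
    (hG : ∀ b, G b ≤ ∑ j ∈ Finset.range k, c₂ * P.mesh j ^ (a₂ - (P.d : ℝ)) *
      Real.exp (-(δ * (P.mesh j)⁻¹ * (P.mesh 0 * (HiggsLattice.Site.tdist b.src y : ℝ))))) :
    ∑ b : HiggsLattice.PBond P 0, F b * G b
      ≤ (P.d : ℝ) * ((c₁ * c₂ * ((nCol N : ℝ) * (8 * P.d / δ) ^ P.d * (P.mesh 0 ^ P.d)⁻¹ *
            ((P.L : ℝ) ^ a₁ / ((P.L : ℝ) ^ a₁ - 1) + (P.L : ℝ) ^ a₂ / ((P.L : ℝ) ^ a₂ - 1)))) /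
          ((P.L : ℝ) ^ (a₁ + a₂ - (P.d : ℝ)) - 1) * P.mesh k ^ (a₁ + a₂ - (P.d : ℝ)) *
          Real.exp (-(δ / 2 * (P.mesh k)⁻¹ * (P.mesh 0 * (HiggsLattice.Site.tdist x y : ℝ))))) := by
  have hL1 : (1 : ℝ) < (P.L : ℝ) := by exact_mod_cast hL
  have hG₁0 : 0 ≤ (P.L : ℝ) ^ a₁ / ((P.L : ℝ) ^ a₁ - 1) := by
    have := Real.one_lt_rpow hL1 ha₁; exact div_nonneg (by linarith) (by linarith)
  have hG₂0 : 0 ≤ (P.L : ℝ) ^ a₂ / ((P.L : ℝ) ^ a₂ - 1) := by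
    have := Real.one_lt_rpow hL1 ha₂; exact div_nonneg (by linarith) (by linarith)
  have hc : 0 ≤ c₁ * c₂ * ((nCol N : ℝ) * (8 * P.d / δ) ^ P.d * (P.mesh 0 ^ P.d)⁻¹ *
      ((P.L : ℝ) ^ a₁ / ((P.L : ℝ) ^ a₁ - 1) + (P.L : ℝ) ^ a₂ / ((P.L : ℝ) ^ a₂ - 1))) := by
    have := inv_nonneg.mpr (pow_nonneg (P.mesh_pos 0).le P.d)
    positivity
  refine (sum_bond_kernel_mul_le hL hδ hδ1 ha₁ ha₂ hc₁ hc₂ i₀ x y F G hF0 hG0 hF hG).trans ?_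
  refine mul_le_mul_of_nonneg_left ?_ (Nat.cast_nonneg _)
  exact majorant_le_top hL hc (by linarith) (by linarith) x y

end Chain2

/-! ## §8 THE FOUR-KERNEL CHAIN of the (1.16) kernel at `n + n′ = 3`, uniformly in `k` -/

section Chain4

/-- **THE FOUR-KERNEL CHAIN BOUND** (the kernel of (1.16) at `n + n′ = 3`: four propagator factors, three `V_k`-insertions summed over the
bonds `b, b′, b″` of `T_ε`), in the exact hypothesis shape of FILE E's `bond_chain3_le`: if four nonnegative kernels are majorized in the
currency with exponents `a₁, a₂, a₃, a₄ > 0` at the rate `δ ∈ (0,1]`, anchors `x → b₋ → b′₋ → b″₋ → x′`, and `a₁ + a₂ + a₃ + a₄ > d`, then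
`Σ_bΣ_{b′}Σ_{b″} F₁(b)F₂(b,b′)F₃(b′,b″)F₄(b″) ≤ C(N,d,L,δ,a)·c₁c₂c₃c₄·(ε^d)^{−3}·(L^kε)^{a₁+a₂+a₃+a₄−d}·exp(−(δ/8)(L^kε)^{−1}ε|x−x′|)`,
UNIFORMLY IN `k` AND IN THE VOLUME — contract `(F₃, F₄)` over `b″` (§6, exponent `a₃ + a₄`, rate `δ/2`, one `ε^{−d}`), weaken `F₁, F₂` to the
rate `δ/2` (§1), and apply `bond_chain3_le` at the rate `δ/2` with exponents `(a₁, a₂, a₃ + a₄)`.  (p35's FILE 4: the derivative / Hölder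
clauses need `n + n′ ≥ 3`, `DESIGN-FILE4.md` §6.) [cite: Balaban1983Higgs3, (1.16) p.414, (2.6) p.424, (2.10) p.426] -/
theorem bond_chain4_le (hL : 1 < P.L) {k : ℕ} {δ : ℝ} (hδ : 0 < δ) (hδ1 : δ ≤ 1) {a₁ a₂ a₃ a₄ : ℝ}
    (ha₁ : 0 < a₁) (ha₂ : 0 < a₂) (ha₃ : 0 < a₃) (ha₄ : 0 < a₄) (hsum : (P.d : ℝ) < a₁ + a₂ + a₃ + a₄)
    {c₁ c₂ c₃ c₄ : ℝ} (hc₁ : 0 ≤ c₁) (hc₂ : 0 ≤ c₂) (hc₃ : 0 ≤ c₃) (hc₄ : 0 ≤ c₄) (i₀ : Ix N)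
    (x x' : HiggsLattice.Site P 0) (F₁ F₄ : HiggsLattice.PBond P 0 → ℝ)
    (F₂ F₃ : HiggsLattice.PBond P 0 → HiggsLattice.PBond P 0 → ℝ)
    (hF₁0 : ∀ b, 0 ≤ F₁ b) (hF₂0 : ∀ b b', 0 ≤ F₂ b b') (hF₃0 : ∀ b' b'', 0 ≤ F₃ b' b'') (hF₄0 : ∀ b'', 0 ≤ F₄ b'')
    (hF₁ : ∀ b, F₁ b ≤ ∑ j ∈ Finset.range k, c₁ * P.mesh j ^ (a₁ - (P.d : ℝ)) *
      Real.exp (-(δ * (P.mesh j)⁻¹ * (P.mesh 0 * (HiggsLattice.Site.tdist x b.src : ℝ)))))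
    (hF₂ : ∀ b b', F₂ b b' ≤ ∑ j ∈ Finset.range k, c₂ * P.mesh j ^ (a₂ - (P.d : ℝ)) *
      Real.exp (-(δ * (P.mesh j)⁻¹ * (P.mesh 0 * (HiggsLattice.Site.tdist b.src b'.src : ℝ)))))
    (hF₃ : ∀ b' b'', F₃ b' b'' ≤ ∑ j ∈ Finset.range k, c₃ * P.mesh j ^ (a₃ - (P.d : ℝ)) *
      Real.exp (-(δ * (P.mesh j)⁻¹ * (P.mesh 0 * (HiggsLattice.Site.tdist b'.src b''.src : ℝ)))))
    (hF₄ : ∀ b'', F₄ b'' ≤ ∑ j ∈ Finset.range k, c₄ * P.mesh j ^ (a₄ - (P.d : ℝ)) *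
      Real.exp (-(δ * (P.mesh j)⁻¹ * (P.mesh 0 * (HiggsLattice.Site.tdist b''.src x' : ℝ))))) :
    ∑ b : HiggsLattice.PBond P 0, ∑ b' : HiggsLattice.PBond P 0, ∑ b'' : HiggsLattice.PBond P 0,
        F₁ b * F₂ b b' * F₃ b' b'' * F₄ b''
      ≤ (P.d : ℝ) ^ 2 * (c₁ * c₂ *
            ((P.d : ℝ) * (c₃ * c₄ * ((nCol N : ℝ) * (8 * P.d / δ) ^ P.d * (P.mesh 0 ^ P.d)⁻¹ *
              ((P.L : ℝ) ^ a₃ / ((P.L : ℝ) ^ a₃ - 1) + (P.L : ℝ) ^ a₄ / ((P.L : ℝ) ^ a₄ - 1))))) *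
          (((nCol N : ℝ) * (8 * P.d / (δ / 2)) ^ P.d) * ((nCol N : ℝ) * (16 * P.d / (δ / 2)) ^ P.d)) *
          ((1 / ((P.L : ℝ) ^ (a₁ * (1 - (P.d : ℝ) / (a₁ + a₂ + a₃ + a₄))) - 1)) *
            (1 / ((P.L : ℝ) ^ (a₂ * (1 - (P.d : ℝ) / (a₁ + a₂ + a₃ + a₄))) - 1)) *
            (1 / ((P.L : ℝ) ^ ((a₃ + a₄) * (1 - (P.d : ℝ) / (a₁ + a₂ + a₃ + a₄))) - 1))) *
          ((P.mesh 0 ^ P.d)⁻¹) ^ 2 * P.mesh k ^ (a₁ + a₂ + a₃ + a₄ - (P.d : ℝ)) *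
          Real.exp (-(δ / 8 * (P.mesh k)⁻¹ * (P.mesh 0 * (HiggsLattice.Site.tdist x x' : ℝ))))) := by
  have hL1 : (1 : ℝ) < (P.L : ℝ) := by exact_mod_cast hL
  have hδ2 : 0 < δ / 2 := half_pos hδ
  have hδ21 : δ / 2 ≤ 1 := by linarith
  have hδle : δ / 2 ≤ δ := by linarith
  -- the constant of the contracted tail
  have hG₃0 : 0 ≤ (P.L : ℝ) ^ a₃ / ((P.L : ℝ) ^ a₃ - 1) := by
    have := Real.one_lt_rpow hL1 ha₃; exact div_nonneg (by linarith) (by linarith)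
  have hG₄0 : 0 ≤ (P.L : ℝ) ^ a₄ / ((P.L : ℝ) ^ a₄ - 1) := by
    have := Real.one_lt_rpow hL1 ha₄; exact div_nonneg (by linarith) (by linarith)
  have hC₃ : 0 ≤ (P.d : ℝ) * (c₃ * c₄ * ((nCol N : ℝ) * (8 * P.d / δ) ^ P.d * (P.mesh 0 ^ P.d)⁻¹ *
      ((P.L : ℝ) ^ a₃ / ((P.L : ℝ) ^ a₃ - 1) + (P.L : ℝ) ^ a₄ / ((P.L : ℝ) ^ a₄ - 1)))) := by
    have := inv_nonneg.mpr (pow_nonneg (P.mesh_pos 0).le P.d)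
    positivity
  -- the contracted tail `H(b′) = Σ_{b″} F₃(b′,b″)F₄(b″)` is majorized with exponent `a₃ + a₄` at the rate `δ/2`
  have hH0 : ∀ b' : HiggsLattice.PBond P 0, 0 ≤ ∑ b'' : HiggsLattice.PBond P 0, F₃ b' b'' * F₄ b'' :=
    fun b' => Finset.sum_nonneg fun b'' _ => mul_nonneg (hF₃0 b' b'') (hF₄0 b'')
  have hH : ∀ b' : HiggsLattice.PBond P 0, ∑ b'' : HiggsLattice.PBond P 0, F₃ b' b'' * F₄ b''
      ≤ ∑ j ∈ Finset.range k, ((P.d : ℝ) * (c₃ * c₄ * ((nCol N : ℝ) * (8 * P.d / δ) ^ P.d * (P.mesh 0 ^ P.d)⁻¹ *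
            ((P.L : ℝ) ^ a₃ / ((P.L : ℝ) ^ a₃ - 1) + (P.L : ℝ) ^ a₄ / ((P.L : ℝ) ^ a₄ - 1))))) *
          P.mesh j ^ (a₃ + a₄ - (P.d : ℝ)) *
          Real.exp (-(δ / 2 * (P.mesh j)⁻¹ * (P.mesh 0 * (HiggsLattice.Site.tdist b'.src x' : ℝ)))) := by
    intro b'
    refine (sum_bond_kernel_mul_le hL hδ hδ1 ha₃ ha₄ hc₃ hc₄ i₀ b'.src x' (F₃ b') F₄ (hF₃0 b') hF₄0
      (hF₃ b') hF₄).trans (le_of_eq ?_)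
    rw [Finset.mul_sum]
    exact Finset.sum_congr rfl fun j _ => by ring
  -- regroup the triple sum
  have hLHS : ∑ b : HiggsLattice.PBond P 0, ∑ b' : HiggsLattice.PBond P 0, ∑ b'' : HiggsLattice.PBond P 0,
        F₁ b * F₂ b b' * F₃ b' b'' * F₄ b''
      = ∑ b : HiggsLattice.PBond P 0, ∑ b' : HiggsLattice.PBond P 0,
          F₁ b * F₂ b b' * ∑ b'' : HiggsLattice.PBond P 0, F₃ b' b'' * F₄ b'' := by
    refine Finset.sum_congr rfl fun b _ => Finset.sum_congr rfl fun b' _ => ?_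
    rw [Finset.mul_sum]
    exact Finset.sum_congr rfl fun b'' _ => by ring
  rw [hLHS]
  -- the three-kernel chain at the rate δ/2 with exponents (a₁, a₂, a₃ + a₄)
  have h3 := bond_chain3_le (k := k) hL hδ2 hδ21 ha₁ ha₂ (add_pos ha₃ ha₄) (by linarith) hc₁ hc₂ hC₃ i₀ x x'
    F₁ (fun b' => ∑ b'' : HiggsLattice.PBond P 0, F₃ b' b'' * F₄ b'') F₂ hF₁0 hF₂0 hH0
    (fun b => (hF₁ b).trans (majorant_rate_mono hc₁ hδle x b.src))
    (fun b b' => (hF₂ b b').trans (majorant_rate_mono hc₂ hδle b.src b'.src)) hH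
  rw [show a₁ + a₂ + (a₃ + a₄) = a₁ + a₂ + a₃ + a₄ by ring, show δ / 2 / 4 = δ / 8 by ring] at h3
  exact h3

end Chain4

/-! ## §9 THE FIVE-KERNEL CHAIN of the (1.16) kernel at `n + n′ = 4` ((n,n′) = (2,2)), uniformly in `k` -/

section Chain5

/-- **THE FIVE-KERNEL CHAIN BOUND** (the kernel of (1.16) at `n = n′ = 2`: five propagator factors, four `V_k`-insertions over the bonds
`b, b′, b″, b‴`), same hypothesis shape: exponents `a₁,…,a₅ > 0` at the rate `δ ∈ (0,1]`, `a₁ + ⋯ + a₅ > d` ⇒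
`Σ F₁F₂F₃F₄F₅ ≤ C·c₁⋯c₅·(ε^d)^{−4}·(L^kε)^{a₁+⋯+a₅−d}·exp(−(δ/16)(L^kε)^{−1}ε|x−x′|)` — one more contraction (§6 on `(F₄,F₅)`) in front of
`bond_chain4_le` at the rate `δ/2`; the pattern for any length. [cite: Balaban1983Higgs3, (1.16) p.414, (2.6) p.424, (2.10) p.426] -/
theorem bond_chain5_le (hL : 1 < P.L) {k : ℕ} {δ : ℝ} (hδ : 0 < δ) (hδ1 : δ ≤ 1) {a₁ a₂ a₃ a₄ a₅ : ℝ}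
    (ha₁ : 0 < a₁) (ha₂ : 0 < a₂) (ha₃ : 0 < a₃) (ha₄ : 0 < a₄) (ha₅ : 0 < a₅)
    (hsum : (P.d : ℝ) < a₁ + a₂ + a₃ + a₄ + a₅)
    {c₁ c₂ c₃ c₄ c₅ : ℝ} (hc₁ : 0 ≤ c₁) (hc₂ : 0 ≤ c₂) (hc₃ : 0 ≤ c₃) (hc₄ : 0 ≤ c₄) (hc₅ : 0 ≤ c₅) (i₀ : Ix N)
    (x x' : HiggsLattice.Site P 0) (F₁ F₅ : HiggsLattice.PBond P 0 → ℝ)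
    (F₂ F₃ F₄ : HiggsLattice.PBond P 0 → HiggsLattice.PBond P 0 → ℝ)
    (hF₁0 : ∀ b, 0 ≤ F₁ b) (hF₂0 : ∀ b b', 0 ≤ F₂ b b') (hF₃0 : ∀ b' b'', 0 ≤ F₃ b' b'')
    (hF₄0 : ∀ b'' b''', 0 ≤ F₄ b'' b''') (hF₅0 : ∀ b''', 0 ≤ F₅ b''')
    (hF₁ : ∀ b, F₁ b ≤ ∑ j ∈ Finset.range k, c₁ * P.mesh j ^ (a₁ - (P.d : ℝ)) *
      Real.exp (-(δ * (P.mesh j)⁻¹ * (P.mesh 0 * (HiggsLattice.Site.tdist x b.src : ℝ)))))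
    (hF₂ : ∀ b b', F₂ b b' ≤ ∑ j ∈ Finset.range k, c₂ * P.mesh j ^ (a₂ - (P.d : ℝ)) *
      Real.exp (-(δ * (P.mesh j)⁻¹ * (P.mesh 0 * (HiggsLattice.Site.tdist b.src b'.src : ℝ)))))
    (hF₃ : ∀ b' b'', F₃ b' b'' ≤ ∑ j ∈ Finset.range k, c₃ * P.mesh j ^ (a₃ - (P.d : ℝ)) *
      Real.exp (-(δ * (P.mesh j)⁻¹ * (P.mesh 0 * (HiggsLattice.Site.tdist b'.src b''.src : ℝ)))))
    (hF₄ : ∀ b'' b''', F₄ b'' b''' ≤ ∑ j ∈ Finset.range k, c₄ * P.mesh j ^ (a₄ - (P.d : ℝ)) *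
      Real.exp (-(δ * (P.mesh j)⁻¹ * (P.mesh 0 * (HiggsLattice.Site.tdist b''.src b'''.src : ℝ)))))
    (hF₅ : ∀ b''', F₅ b''' ≤ ∑ j ∈ Finset.range k, c₅ * P.mesh j ^ (a₅ - (P.d : ℝ)) *
      Real.exp (-(δ * (P.mesh j)⁻¹ * (P.mesh 0 * (HiggsLattice.Site.tdist b'''.src x' : ℝ))))) :
    ∑ b : HiggsLattice.PBond P 0, ∑ b' : HiggsLattice.PBond P 0, ∑ b'' : HiggsLattice.PBond P 0,
        ∑ b''' : HiggsLattice.PBond P 0, F₁ b * F₂ b b' * F₃ b' b'' * F₄ b'' b''' * F₅ b'''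
      ≤ (P.d : ℝ) ^ 2 * (c₁ * c₂ *
            ((P.d : ℝ) * (c₃ * ((P.d : ℝ) * (c₄ * c₅ * ((nCol N : ℝ) * (8 * P.d / δ) ^ P.d * (P.mesh 0 ^ P.d)⁻¹ *
                ((P.L : ℝ) ^ a₄ / ((P.L : ℝ) ^ a₄ - 1) + (P.L : ℝ) ^ a₅ / ((P.L : ℝ) ^ a₅ - 1))))) *
              ((nCol N : ℝ) * (8 * P.d / (δ / 2)) ^ P.d * (P.mesh 0 ^ P.d)⁻¹ *
              ((P.L : ℝ) ^ a₃ / ((P.L : ℝ) ^ a₃ - 1) + (P.L : ℝ) ^ (a₄ + a₅) / ((P.L : ℝ) ^ (a₄ + a₅) - 1))))) *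
          (((nCol N : ℝ) * (8 * P.d / (δ / 4)) ^ P.d) * ((nCol N : ℝ) * (16 * P.d / (δ / 4)) ^ P.d)) *
          ((1 / ((P.L : ℝ) ^ (a₁ * (1 - (P.d : ℝ) / (a₁ + a₂ + a₃ + a₄ + a₅))) - 1)) *
            (1 / ((P.L : ℝ) ^ (a₂ * (1 - (P.d : ℝ) / (a₁ + a₂ + a₃ + a₄ + a₅))) - 1)) *
            (1 / ((P.L : ℝ) ^ ((a₃ + (a₄ + a₅)) * (1 - (P.d : ℝ) / (a₁ + a₂ + a₃ + a₄ + a₅))) - 1))) *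
          ((P.mesh 0 ^ P.d)⁻¹) ^ 2 * P.mesh k ^ (a₁ + a₂ + a₃ + a₄ + a₅ - (P.d : ℝ)) *
          Real.exp (-(δ / 16 * (P.mesh k)⁻¹ * (P.mesh 0 * (HiggsLattice.Site.tdist x x' : ℝ))))) := by
  have hL1 : (1 : ℝ) < (P.L : ℝ) := by exact_mod_cast hL
  have hδ2 : 0 < δ / 2 := half_pos hδ
  have hδ21 : δ / 2 ≤ 1 := by linarith
  have hδle : δ / 2 ≤ δ := by linarith
  have hG₄0 : 0 ≤ (P.L : ℝ) ^ a₄ / ((P.L : ℝ) ^ a₄ - 1) := by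
    have := Real.one_lt_rpow hL1 ha₄; exact div_nonneg (by linarith) (by linarith)
  have hG₅0 : 0 ≤ (P.L : ℝ) ^ a₅ / ((P.L : ℝ) ^ a₅ - 1) := by
    have := Real.one_lt_rpow hL1 ha₅; exact div_nonneg (by linarith) (by linarith)
  have hC₄ : 0 ≤ (P.d : ℝ) * (c₄ * c₅ * ((nCol N : ℝ) * (8 * P.d / δ) ^ P.d * (P.mesh 0 ^ P.d)⁻¹ *
      ((P.L : ℝ) ^ a₄ / ((P.L : ℝ) ^ a₄ - 1) + (P.L : ℝ) ^ a₅ / ((P.L : ℝ) ^ a₅ - 1)))) := by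
    have := inv_nonneg.mpr (pow_nonneg (P.mesh_pos 0).le P.d)
    positivity
  -- the contracted tail `H(b″) = Σ_{b‴} F₄(b″,b‴)F₅(b‴)`: exponent `a₄ + a₅`, rate `δ/2`
  have hH0 : ∀ b'' : HiggsLattice.PBond P 0, 0 ≤ ∑ b''' : HiggsLattice.PBond P 0, F₄ b'' b''' * F₅ b''' :=
    fun b'' => Finset.sum_nonneg fun b''' _ => mul_nonneg (hF₄0 b'' b''') (hF₅0 b''')
  have hH : ∀ b'' : HiggsLattice.PBond P 0, ∑ b''' : HiggsLattice.PBond P 0, F₄ b'' b''' * F₅ b'''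
      ≤ ∑ j ∈ Finset.range k, ((P.d : ℝ) * (c₄ * c₅ * ((nCol N : ℝ) * (8 * P.d / δ) ^ P.d * (P.mesh 0 ^ P.d)⁻¹ *
            ((P.L : ℝ) ^ a₄ / ((P.L : ℝ) ^ a₄ - 1) + (P.L : ℝ) ^ a₅ / ((P.L : ℝ) ^ a₅ - 1))))) *
          P.mesh j ^ (a₄ + a₅ - (P.d : ℝ)) *
          Real.exp (-(δ / 2 * (P.mesh j)⁻¹ * (P.mesh 0 * (HiggsLattice.Site.tdist b''.src x' : ℝ)))) := by
    intro b''
    refine (sum_bond_kernel_mul_le hL hδ hδ1 ha₄ ha₅ hc₄ hc₅ i₀ b''.src x' (F₄ b'') F₅ (hF₄0 b'') hF₅0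
      (hF₄ b'') hF₅).trans (le_of_eq ?_)
    rw [Finset.mul_sum]
    exact Finset.sum_congr rfl fun j _ => by ring
  -- regroup the quadruple sum
  have hLHS : ∑ b : HiggsLattice.PBond P 0, ∑ b' : HiggsLattice.PBond P 0, ∑ b'' : HiggsLattice.PBond P 0,
        ∑ b''' : HiggsLattice.PBond P 0, F₁ b * F₂ b b' * F₃ b' b'' * F₄ b'' b''' * F₅ b'''
      = ∑ b : HiggsLattice.PBond P 0, ∑ b' : HiggsLattice.PBond P 0, ∑ b'' : HiggsLattice.PBond P 0,
          F₁ b * F₂ b b' * F₃ b' b'' * ∑ b''' : HiggsLattice.PBond P 0, F₄ b'' b''' * F₅ b''' := by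
    refine Finset.sum_congr rfl fun b _ => Finset.sum_congr rfl fun b' _ => Finset.sum_congr rfl fun b'' _ => ?_
    rw [Finset.mul_sum]
    exact Finset.sum_congr rfl fun b''' _ => by ring
  rw [hLHS]
  -- the four-kernel chain at the rate δ/2 with exponents (a₁, a₂, a₃, a₄ + a₅)
  have h4 := bond_chain4_le (k := k) hL hδ2 hδ21 ha₁ ha₂ ha₃ (add_pos ha₄ ha₅) (by linarith) hc₁ hc₂ hc₃ hC₄ i₀ x x'
    F₁ (fun b'' => ∑ b''' : HiggsLattice.PBond P 0, F₄ b'' b''' * F₅ b''') F₂ F₃ hF₁0 hF₂0 hF₃0 hH0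
    (fun b => (hF₁ b).trans (majorant_rate_mono hc₁ hδle x b.src))
    (fun b b' => (hF₂ b b').trans (majorant_rate_mono hc₂ hδle b.src b'.src))
    (fun b' b'' => (hF₃ b' b'').trans (majorant_rate_mono hc₃ hδle b'.src b''.src)) hH
  rw [show a₁ + a₂ + a₃ + (a₄ + a₅) = a₁ + a₂ + a₃ + a₄ + a₅ by ring, show δ / 2 / 8 = δ / 16 by ring,
    show δ / 2 / 2 = δ / 4 by ring] at h4
  exact h4

end Chain5

/-! ## §10 (v1.1) The `ℓ²`-COLUMN of a majorant of ANY exponent `a` with `2a > d` — the sup/`L²` interface for general `(n, n′)` -/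

section Columns

open B1Ineq234Concrete (tdist_self)

/-- **The `ℓ²`-norm of a majorant column**: for `a > 0` with `2a > d`, `0 < δ ≤ 1`, `L > 1`,
`Σ_u ε^d·𝔪(c,a;δ)(x,u)² ≤ c²·N(8d/δ)^d·2L^a(L^a−1)^{−1}(L^{2a−d}−1)^{−1}·(L^kε)^{2a−d}`, UNIFORMLY in `k` and `x` — by symmetry of the distance
the square is the self-convolution of §5 read at `y = x`, followed by §2.  FILE E's `sq_col_le` is the case `a = 2` (an undifferentiated
outer propagator column, `d ≤ 3`); this version serves an OUTER SUP-SEGMENT of any length contracted by §5/§6 into one majorant of exponent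
`A = Σa_i` (then `2A > d` holds as soon as `A ≥ 2`), which is the vector paired in `ℓ²` against the `L²`-bounded middle of a long chain of (1.16)
(r14's «outer blocks by kernels with ℓ²-summable columns, middle in L²», `DESIGN-B3-116-analytic.md` §2 (a)–(b)).
[cite: Balaban1983Higgs3, (1.16) p.414, (2.6) p.424, (2.10) p.426] [cite: Balaban1983RegularityDecay, Sect. 5 Theorem p.594] -/
theorem sum_sq_majorant_le (hL : 1 < P.L) {k : ℕ} {δ : ℝ} (hδ : 0 < δ) (hδ1 : δ ≤ 1) {a c : ℝ} (ha : 0 < a)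
    (h2a : (P.d : ℝ) < a + a) (hc : 0 ≤ c) (i₀ : Ix N) (x : HiggsLattice.Site P 0) :
    ∑ u : HiggsLattice.Site P 0, P.mesh 0 ^ P.d *
        (∑ j ∈ Finset.range k, c * P.mesh j ^ (a - (P.d : ℝ)) *
            Real.exp (-(δ * (P.mesh j)⁻¹ * (P.mesh 0 * (HiggsLattice.Site.tdist x u : ℝ))))) ^ 2
      ≤ P.mesh 0 ^ P.d * ((c * c * ((nCol N : ℝ) * (8 * P.d / δ) ^ P.d * (P.mesh 0 ^ P.d)⁻¹ *
            ((P.L : ℝ) ^ a / ((P.L : ℝ) ^ a - 1) + (P.L : ℝ) ^ a / ((P.L : ℝ) ^ a - 1)))) /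
          ((P.L : ℝ) ^ (a + a - (P.d : ℝ)) - 1) * P.mesh k ^ (a + a - (P.d : ℝ))) := by
  have hL1 : (1 : ℝ) < (P.L : ℝ) := by exact_mod_cast hL
  have hG0 : 0 ≤ (P.L : ℝ) ^ a / ((P.L : ℝ) ^ a - 1) := by
    have := Real.one_lt_rpow hL1 ha; exact div_nonneg (by linarith) (by linarith)
  have hC : 0 ≤ c * c * ((nCol N : ℝ) * (8 * P.d / δ) ^ P.d * (P.mesh 0 ^ P.d)⁻¹ *
      ((P.L : ℝ) ^ a / ((P.L : ℝ) ^ a - 1) + (P.L : ℝ) ^ a / ((P.L : ℝ) ^ a - 1))) := by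
    have := inv_nonneg.mpr (pow_nonneg (P.mesh_pos 0).le P.d)
    positivity
  -- the square of the column is its self-convolution read at `y = x`
  have hsq : ∀ u : HiggsLattice.Site P 0,
      (∑ j ∈ Finset.range k, c * P.mesh j ^ (a - (P.d : ℝ)) *
          Real.exp (-(δ * (P.mesh j)⁻¹ * (P.mesh 0 * (HiggsLattice.Site.tdist x u : ℝ))))) ^ 2
        = (∑ j ∈ Finset.range k, c * P.mesh j ^ (a - (P.d : ℝ)) *
            Real.exp (-(δ * (P.mesh j)⁻¹ * (P.mesh 0 * (HiggsLattice.Site.tdist x u : ℝ))))) *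
          (∑ j ∈ Finset.range k, c * P.mesh j ^ (a - (P.d : ℝ)) *
            Real.exp (-(δ * (P.mesh j)⁻¹ * (P.mesh 0 * (HiggsLattice.Site.tdist u x : ℝ))))) := by
    intro u; rw [sq, tdist_comm u x]
  simp_rw [hsq]
  rw [← Finset.mul_sum]
  refine mul_le_mul_of_nonneg_left ?_ (pow_nonneg (P.mesh_pos 0).le _)
  refine (conv_majorant_le hL hδ hδ1 ha ha hc hc i₀ x x).trans ?_
  refine (majorant_le_top hL hC (by linarith) (by linarith) x x).trans (le_of_eq ?_)
  rw [tdist_self]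
  simp

/-- **The `ℓ²`-norm of a kernel column majorized with exponent `a`, `2a > d`** (`0 ≤ F(u) ≤ 𝔪(c,a;δ)(x,u)`): the same bound for
`Σ_u ε^d F(u)²`. [cite: Balaban1983Higgs3, (1.16) p.414, (2.6) p.424, (2.10) p.426] -/
theorem sum_sq_kernel_le (hL : 1 < P.L) {k : ℕ} {δ : ℝ} (hδ : 0 < δ) (hδ1 : δ ≤ 1) {a c : ℝ} (ha : 0 < a)
    (h2a : (P.d : ℝ) < a + a) (hc : 0 ≤ c) (i₀ : Ix N) (x : HiggsLattice.Site P 0) (F : HiggsLattice.Site P 0 → ℝ)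
    (hF0 : ∀ u, 0 ≤ F u)
    (hF : ∀ u, F u ≤ ∑ j ∈ Finset.range k, c * P.mesh j ^ (a - (P.d : ℝ)) *
      Real.exp (-(δ * (P.mesh j)⁻¹ * (P.mesh 0 * (HiggsLattice.Site.tdist x u : ℝ))))) :
    ∑ u : HiggsLattice.Site P 0, P.mesh 0 ^ P.d * F u ^ 2
      ≤ P.mesh 0 ^ P.d * ((c * c * ((nCol N : ℝ) * (8 * P.d / δ) ^ P.d * (P.mesh 0 ^ P.d)⁻¹ *
            ((P.L : ℝ) ^ a / ((P.L : ℝ) ^ a - 1) + (P.L : ℝ) ^ a / ((P.L : ℝ) ^ a - 1)))) /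
          ((P.L : ℝ) ^ (a + a - (P.d : ℝ)) - 1) * P.mesh k ^ (a + a - (P.d : ℝ))) := by
  refine le_trans (Finset.sum_le_sum fun u _ => ?_) (sum_sq_majorant_le hL hδ hδ1 ha h2a hc i₀ x)
  exact mul_le_mul_of_nonneg_left (pow_le_pow_left₀ (hF0 u) (hF u) 2) (pow_nonneg (P.mesh_pos 0).le _)

end Columns

end Literature.MathematicalPhysics.QuantumFieldTheory.Balaban1983to89.B3Op116MajorantConvolution

end
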